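import Summits.QuantumFields.BalabanUV.Beta.EriceRemainderEnclosureHistoryAutonomyComparisonAgeCompositionEnteringLagLevels

/-!
# EriceRemainderEnclosureHistoryAutonomyComparisonAgeCompositionEnteringLagLevelsAbs — (E87k) route (N), first order: THE STATIC FAMILY (S-h) WITH THE YOUNG
# DROPS BOUNDED BELOW ABSOLUTELY — the family (S-h°): below the edge the older truncation surplus `v` lies in `[vlo, 1]`, so the young solution `t`
# (`t = v − Ry t`, `0 ≤ t ≤ v`) satisfies, lag by lag, `t(p') ≥ max((1−ρ(p'))·vlo(n+2), (1−ρ(p'))·vlo(p'), vlo(p') − x̃_y(p'), 0)` — the KEY branch of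
# (S-h♯) ((E87e)), the KEY branch at the lag's own pin, and the CHAIN-FREE branch `v − Ry v ≥ vlo − (young row mass)`; the entering lag reads `t ≤ 1`

Cell `pub-balaban`, β-function sub-cell, BINDER row D4 «RemainderConst leaves for Bałaban's split» (`HOME/BINDER-OWNERS.md`; owner lineage `b2b-balaban-beta-an4`;
this file by co-owner #2 lineage `b2b-balaban-beta-d4-p2`, generation 78), β-FLOW TEAM duty (1), FREEZE (0) honoured (def-free; imports (E86c); uses (E86c)
`mono_chain` ∕ `sol_support` ∕ `sol_lower`, (E83a) `read_succ_onelag`, (E71a) `sol_nonneg_le_of_supersol` ∕ `read_nonneg` ∕ `read_le_read` BY NAME; nothing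
restated).

HONEST FRAMING (page 1, verbatim and binding).  *"Discharging BetaPertH makes Bałaban's UV stability UNCONDITIONAL — a real constructive-QFT result; it is
NOT the continuum limit and NOT the Clay problem."*  THIS FILE DISCHARGES NOTHING OF THE KIND.  Elementary real analysis about ABSTRACT non-negative window
kernels and the FIRST-ORDER renewal objects of route (N); the objects it will serve are built on the cell's own NOT-IN-PRINT binders (the age profile of
Bałaban's (1.22) limit functional is NOT PRINTED — [I] p. 298; GAPS G-t4-U2-1∕-2) and NOT asserted.  Row D4 class UNCHANGED (critical-path width 0; instance
0∕1; D4 DISCHARGE NO DATE).  HONEST DEPENDENCY: continuum YM on T⁴ ⇐ BetaPertH ∧ nine spine estimates (0/9 proved); BetaPertH ⇐ (D1) ∧ (D4) ∧ CAP+tail;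
G-an2-4 gates asym, D1 and NE2/3/4.

THE POINT (census sense (α); route (N); README `HOME/b2b-balaban-beta-d4-p2/g78/e87/README.md` §2–§3).  (S-h♯) ((E87e)) bounds every young drop on the right
through the KEY ratio alone (`t ≥ (1−ρ)v ≥ (1−ρ)·vlo(n+2)`); its damping-free form needs a MAJORANT of the middle age's chain ratio, and the flow majorant
`ρUp` of (E87i) exceeds `1` in the corner of two comparably long, both loaded old ages (generation-78 adversarial census, README §2(d)) — there the young
lower mass is clipped to `0`.  The chain-free branch `t = v − Ry t ≥ v − Ry v ≥ vlo − x̃_y` needs no ratio at all and is positive exactly there.  §1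
**`old_read_antitone_of_decay_defect_abs`**: (E87e)'s conclusion from the family **(S-h°)** at the pins `n+1+yo ≤ j`:
`Ko (n+1)(yo−1)·Σ_{l<y} [n+2+yo+l ≤ j]·Ky (n+1+yo) l ≤ (1−σo_n)·Σ_{l'<yo} Ko n l'·A_n(n+1+l') + σo_n·Ko n 0·A_n(n+1)`, with the ABSOLUTE young lower
masses `A_n(p) = Σ_{l<y} [p+1+l ≤ j]·Ky p l·τ_n(p+1+l)`, `τ_n(p') = max((1−ρ(p'))·vlo(n+2), (1−ρ(p'))·vlo(p'), vlo(p') − Σ_{l<N} Ky p' l, 0)` — it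
dominates (S-h♯) whenever `vlo(n+2) ≥ 0`.  NUMERICS OF RECORD (`g78/numerics/shcomb.py`; benchmark three-age flows, pins `≤ 2`, `k₃ ≤ 32`): exact log-ratio of
(S-h°) (three-age instance: `vlo = 1 − x̃₃`, `x̃_y = x̃₂`) `−0.63 … −1.07` where (S-h♯) reads `−0.60 … −0.86`; its damping-free form `−0.60∕−0.45∕−0.34`
(`k₃ = 8∕16∕32`) where (S-h♯)'s reads `−0.53∕−0.39∕−0.29`.  NOT CLAIMED: (S-h°) along flows; anything nonlinear; anything printed — NOT B12 Thm 2, NOT BetaPertH.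

WHAT IS PROVED ([folklore]; 0 `def`, 0 sorry).  §1 **`old_read_antitone_of_decay_defect_abs`**.
-/
noncomputable section
open Finset

namespace Summit.QuantumFields.BalabanUV.Beta.EriceRemainderEnclosureHistoryAutonomyComparisonAgeCompositionEnteringLagLevelsAbs

open Summit.QuantumFields.BalabanUV.Beta.EriceRemainderEnclosureHistoryAutonomyComparisonAgeComposition
open Summit.QuantumFields.BalabanUV.Beta.EriceRemainderEnclosureHistoryAutonomyComparisonAgeCompositionEnteringLag (read_succ_onelag)
open Summit.QuantumFields.BalabanUV.Beta.EriceRemainderEnclosureHistoryAutonomyComparisonAgeCompositionEnteringLagLevels (mono_chain sol_support sol_lower)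

variable {N y : ℕ}

/-! ## §1 (S-h°): absolute young lower masses -/

/-- **(MONO) FOR A PAIR OF MULTI-LAG AGES FROM DECAY AND DEFECT — THE ABSOLUTE FAMILY (S-h°).**  Young kernel `Ky ≥ 0` with `y ≥ 1` lags, reads `Ry`; input
`v` with `0 ≤ v ≤ 1`, supported on `[0,j]`, non-decreasing below the edge, `vlo p ≤ v p` for `p ≤ j`; KEY ratio `ρ ≤ 1`; young solution `t`; old window
kernel `Ko ≥ 0` with `yo ≥ 1` lags, reads `Ro`, one-lag structure `σo ∈ [0,1]`.  Absolute young lower masses `A_n(p) = Σ_{l<y} [p+1+l ≤ j]·Ky p l·τ_n(p+1+l)`,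
`τ_n(p') = max (max (max ((1−ρ p')·vlo(n+2)) ((1−ρ p')·vlo p')) (vlo p' − Σ_{l<N} Ky p' l)) 0`.  IF **(S-h°)** holds at the pins `n+1+yo ≤ j`:
`Ko (n+1)(yo−1)·Σ_{l<y} [n+2+yo+l ≤ j]·Ky (n+1+yo) l ≤ (1−σo_n)·Σ_{l'<yo} Ko n l'·A_n(n+1+l') + σo_n·Ko n 0·A_n(n+1)`, THEN `Ro (Ry t) (n+1) ≤ Ro (Ry t) n`
at every pin.  (Lag by lag below the edge: `t(p') ≥ (1−ρ(p'))v(p')` (KEY) with `v(p') ≥ v(n+2) ≥ vlo(n+2)` or `v(p') ≥ vlo(p')`; `t(p') ≥ v(p') − Ry v (p') ≥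
vlo(p') − Σ_l Ky p' l` (`t ≤ v ≤ 1`); `t ≥ 0`; the entering lag reads `t ≤ 1`; the rest is (E83a)'s identity.) [folklore] -/
theorem old_read_antitone_of_decay_defect_abs
    {Ky : ℕ → ℕ → ℝ} {Ry : (ℕ → ℝ) → ℕ → ℝ}
    (hRy : ∀ v n, Ry v n = ∑ l ∈ range N, Ky n l * v (n + 1 + l)) (hKy : ∀ n l, 0 ≤ Ky n l) (hKyy : ∀ n l, y ≤ l → Ky n l = 0) (hyN : y ≤ N)
    {yo : ℕ} {Ko : ℕ → ℕ → ℝ} {Ro : (ℕ → ℝ) → ℕ → ℝ} {σo : ℕ → ℝ}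
    (hRo : ∀ v n, Ro v n = ∑ l ∈ range N, Ko n l * v (n + 1 + l)) (hKo : ∀ n l, 0 ≤ Ko n l) (hKoy : ∀ n l, yo ≤ l → Ko n l = 0)
    (hyo : 1 ≤ yo) (hyoN : yo ≤ N)
    (hσo : ∀ n l, l + 1 < yo → Ko (n + 1) l = σo n * Ko n (l + 1)) (hσo01 : ∀ n, 0 ≤ σo n ∧ σo n ≤ 1)
    {v : ℕ → ℝ} {j : ℕ} (hv0 : ∀ n, 0 ≤ v n) (hv1 : ∀ n, v n ≤ 1) (hvj : ∀ n, j < n → v n = 0) (hmono : ∀ m, m < j → v m ≤ v (m + 1))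
    {vlo : ℕ → ℝ} (hvlo : ∀ p, p ≤ j → vlo p ≤ v p)
    {ρ : ℕ → ℝ} (hkey : ∀ n, Ry v n ≤ ρ n * v n) (hρ1 : ∀ n, ρ n ≤ 1)
    {t : ℕ → ℝ} (htail : ∀ n, N < n → t n = 0) (hrec : ∀ n, t n = v n - Ry t n)
    {τ A : ℕ → ℕ → ℝ}
    (hτ : ∀ n p', τ n p' = max (max (max ((1 - ρ p') * vlo (n + 2)) ((1 - ρ p') * vlo p')) (vlo p' - ∑ l ∈ range N, Ky p' l)) 0)
    (hA : ∀ n p, A n p = ∑ l ∈ range y, if p + 1 + l ≤ j then Ky p l * τ n (p + 1 + l) else 0)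
    (hSh : ∀ n, n + 1 + yo ≤ j →
      Ko (n + 1) (yo - 1) * ∑ l ∈ range y, (if n + 2 + yo + l ≤ j then Ky (n + 1 + yo) l else 0) ≤
        (1 - σo n) * ∑ l' ∈ range yo, Ko n l' * A n (n + 1 + l') + σo n * (Ko n 0 * A n (n + 1))) :
    ∀ n, Ro (Ry t) (n + 1) ≤ Ro (Ry t) n := by
  have hsup : ∀ n, Ry v n ≤ v n := fun n => (hkey n).trans (by nlinarith [hρ1 n, hv0 n])
  have htv := sol_nonneg_le_of_supersol hRy hKy hv0 hsup htail hrec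
  have ht0 := sol_support hvj htv
  have htlow := sol_lower hRy hKy hkey htv hrec
  -- the young drops: signs, support
  set d : ℕ → ℝ := Ry t with hd
  have hd0 : ∀ p, 0 ≤ d p := fun p => read_nonneg hRy hKy fun m _ => (htv m).1
  have hdz : ∀ p, j < p + 1 → d p = 0 := fun p hp => by
    rw [hd, hRy]; exact sum_eq_zero fun l _ => by rw [ht0 _ (by omega), mul_zero]
  have hτ0 : ∀ n p', 0 ≤ τ n p' := fun n p' => by rw [hτ]; exact le_max_right _ _
  have hA0 : ∀ n p, 0 ≤ A n p := fun n p => by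
    rw [hA]; exact sum_nonneg fun l _ => by split_ifs <;> [exact mul_nonneg (hKy p l) (hτ0 _ _); exact le_rfl]
  -- THE THREE BRANCHES: below the edge and beyond the pin `n+2`, `τ_n(p') ≤ t(p')`
  have hτt : ∀ n p', n + 2 ≤ p' → p' ≤ j → τ n p' ≤ t p' := by
    intro n p' hnp hpj
    have hρ0 : 0 ≤ 1 - ρ p' := by linarith [hρ1 p']
    have hkey' : (1 - ρ p') * v p' ≤ t p' := htlow p'
    have hb1 : (1 - ρ p') * vlo (n + 2) ≤ t p' := by
      have h1 : vlo (n + 2) ≤ v p' := (hvlo (n + 2) (by omega)).trans (mono_chain hmono (p' - (n + 2)) (n + 2) (by omega) |>.trans (by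
        rw [show n + 2 + (p' - (n + 2)) = p' by omega]))
      exact (mul_le_mul_of_nonneg_left h1 hρ0).trans hkey'
    have hb2 : (1 - ρ p') * vlo p' ≤ t p' := (mul_le_mul_of_nonneg_left (hvlo p' hpj) hρ0).trans hkey'
    have hb3 : vlo p' - ∑ l ∈ range N, Ky p' l ≤ t p' := by
      have hRv : Ry v p' ≤ ∑ l ∈ range N, Ky p' l := by
        have h := read_le_read hRy hKy (t := v) (v := fun _ => (1:ℝ)) (n := p') fun m _ => hv1 m
        have e : Ry (fun _ => (1:ℝ)) p' = ∑ l ∈ range N, Ky p' l := by rw [hRy]; exact sum_congr rfl fun l _ => mul_one _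
        linarith
      have hRt : Ry t p' ≤ Ry v p' := read_le_read hRy hKy fun m _ => (htv m).2
      rw [hrec p']; linarith [hvlo p' hpj]
    rw [hτ]
    exact max_le (max_le (max_le hb1 hb2) hb3) (htv p').1
  -- hence every old lag reads a young drop at least `A_n`
  have hdlow : ∀ n p, n + 1 ≤ p → A n p ≤ d p := by
    intro n p hnp
    rw [hA, hd, hRy]
    have hsub : ∑ l ∈ range y, Ky p l * t (p + 1 + l) ≤ ∑ l ∈ range N, Ky p l * t (p + 1 + l) :=
      sum_le_sum_of_subset_of_nonneg (range_subset_range.mpr hyN) fun l _ _ => mul_nonneg (hKy p l) (htv _).1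
    refine le_trans (sum_le_sum fun l _ => ?_) hsub
    split_ifs with hpl
    · exact mul_le_mul_of_nonneg_left (hτt n (p + 1 + l) (by omega) hpl) (hKy p l)
    · exact mul_nonneg (hKy p l) (htv _).1
  have hdup : ∀ n, d (n + 1 + yo) ≤ ∑ l ∈ range y, (if n + 2 + yo + l ≤ j then Ky (n + 1 + yo) l else 0) := by
    intro n
    rw [hd, hRy]
    have heq : ∑ l ∈ range N, Ky (n + 1 + yo) l * t (n + 1 + yo + 1 + l) = ∑ l ∈ range y, Ky (n + 1 + yo) l * t (n + 1 + yo + 1 + l) :=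
      (sum_subset (range_subset_range.mpr hyN) fun l _ hly => by
        rw [hKyy _ l (by rw [mem_range, not_lt] at hly; exact hly), zero_mul]).symm
    rw [heq]
    refine sum_le_sum fun l _ => ?_
    split_ifs with hlj
    · have h1 : t (n + 1 + yo + 1 + l) ≤ 1 := (htv _).2.trans (hv1 _)
      nlinarith [hKy (n + 1 + yo) l, h1]
    · rw [ht0 _ (by omega), mul_zero]
  -- the old kernel reading the young drops: identity, leaving term, criterion
  intro n
  have hid := read_succ_onelag hRo hKoy hyo hyoN hσo d n
  have hcrit : Ko (n + 1) (yo - 1) * d (n + 1 + yo) ≤ (1 - σo n) * Ro d n + σo n * (Ko n 0 * d (n + 1)) → Ro d (n + 1) ≤ Ro d n := by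
    intro h
    have e1 : σo n * (Ro d n - Ko n 0 * d (n + 1)) = σo n * Ro d n - σo n * (Ko n 0 * d (n + 1)) := by ring
    have e2 : (1 - σo n) * Ro d n = Ro d n - σo n * Ro d n := by ring
    rw [hid]; linarith
  by_cases hedge : j < n + 1 + yo
  · -- free: the young drops vanish beyond the edge
    refine hcrit ?_
    rw [hdz _ (by omega), mul_zero]
    have h1 : 0 ≤ (1 - σo n) * Ro d n := mul_nonneg (by linarith [(hσo01 n).2]) (read_nonneg hRo hKo fun m _ => hd0 m)
    have h2 : 0 ≤ σo n * (Ko n 0 * d (n + 1)) := mul_nonneg (hσo01 n).1 (mul_nonneg (hKo n 0) (hd0 _))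
    linarith
  · have hnj : n + 1 + yo ≤ j := by omega
    refine hcrit ?_
    have hlow : ∑ l' ∈ range yo, Ko n l' * A n (n + 1 + l') ≤ Ro d n := by
      rw [hRo]
      have hsub : ∑ l ∈ range yo, Ko n l * d (n + 1 + l) ≤ ∑ l ∈ range N, Ko n l * d (n + 1 + l) :=
        sum_le_sum_of_subset_of_nonneg (range_subset_range.mpr hyoN) fun l _ _ => mul_nonneg (hKo n l) (hd0 _)
      exact le_trans (sum_le_sum fun l _ => mul_le_mul_of_nonneg_left (hdlow n _ (by omega)) (hKo n l)) hsub
    have hlow0 : Ko n 0 * A n (n + 1) ≤ Ko n 0 * d (n + 1) := mul_le_mul_of_nonneg_left (hdlow n _ (by omega)) (hKo n 0)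
    have h1 : Ko (n + 1) (yo - 1) * d (n + 1 + yo) ≤ Ko (n + 1) (yo - 1) * ∑ l ∈ range y, (if n + 2 + yo + l ≤ j then Ky (n + 1 + yo) l else 0) :=
      mul_le_mul_of_nonneg_left (hdup n) (hKo _ _)
    have h2 : (1 - σo n) * ∑ l' ∈ range yo, Ko n l' * A n (n + 1 + l') ≤ (1 - σo n) * Ro d n :=
      mul_le_mul_of_nonneg_left hlow (by linarith [(hσo01 n).2])
    have h3 : σo n * (Ko n 0 * A n (n + 1)) ≤ σo n * (Ko n 0 * d (n + 1)) := mul_le_mul_of_nonneg_left hlow0 (hσo01 n).1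
    linarith [hSh n hnj]

end Summit.QuantumFields.BalabanUV.Beta.EriceRemainderEnclosureHistoryAutonomyComparisonAgeCompositionEnteringLagLevelsAbs

end
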